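import Summits.ValiantsHypothesis.ValiantsHypothesis.Theorems.LacunarySymmetroidMatrixDescartesCensusDoorA34Letters

/-!
# `MatrixDescartes` census — DOOR A at `(3,4)`: TWO SINGULAR LETTERS cost TWO monomials — the null-null stratum has ceiling `17`

HONEST FRAMING.  Object-search cell `pub-symmetroid`, door-A seat `val-sym-door-p3` (g10); beside the OPEN typed statement
`DoorA34 = PosRootLawAt 3 4 18` (route item `Theses.LacunarySymmetroid.DoorA34`, stmt-ValiantsHypothesis-19980), asserted nowhere.
The singular-letter sector (`Census.posRoots_le_18_of_det_letter_eq_zero`, …CensusDoorA34Letters) says one singular letter costs the cube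
monomial `X^(3·d l)` and caps the count at `18`.  This file records the two-letter version, for ALL real `3 × 3` letters (symmetry not used):

* `card_support_le_18_of_two_singular_letters` — if the cube exponents `3·d i ≠ 3·d j` are each represented only by `{i,i,i}` resp.
  `{j,j,j}` among the triple sums (automatic on a 3-Sidon support) and `det (S i) = det (S j) = 0`, then `det (∑ₗ X^(d l) • S l)` has at
  most `18` monomials;
* `posRoots_le_17_of_two_singular_letters` — hence at most `17` distinct positive roots (sparse Descartes);
* `posRoots_le_17_of_singular_ends` — the instance the census reads: BOTH END letters singular (`det S 0 = det S 3 = 0`).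

WHY THE CELL RECORDS IT (located, seat report HOME/DOOR-A34-P3G10-REPORT.md §2b): every BULK census maximiser of `ζ_sym(3,4)` of record
(the `W`-family seventeens on `(0,4,9,16)`, `(0,5,11,19)`, `(0,6,13,22)`, `(0,8,14,23)`, `(0,10,22,38)`, and the rail rows) has BOTH end
letters within `10⁻¹⁰ … 10⁻²⁰` (normalised `|det S_l| / ‖S_l‖³`) of singular while its four letters are far from linearly dependent
(Gram spectrum ≥ 0.08): the bulk extremals are tiny unfoldings of the NULL-NULL STRATUM `{det S 0 = det S 3 = 0}`.  On that stratum this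
file gives the Descartes ceiling `17` = the census bulk value, while the tree's NULL-NULL LIFT (`Census.nineteen_of_nullNull_seventeen`,
…CensusDoorA34NullNullLift) turns a stratum (chain-)seventeen into a nineteen.  So, read together: `DoorA34` holds on a 3-Sidon support only
if the null-null stratum is Descartes-DEFICIENT there (no chain-seventeen with two adjugate-rank end letters), and the present file is the
trivial half (`≤ 17`) of that stratum question; the stratum objects under the census seventeens carry `15` (located: the two end roots
`t ≈ (c₀/c₁)^{1/d₁}` run to `0` and `∞` with the end determinants).  Nothing here decides the stratum question.

Nothing here bounds `ζ_sym(3,4)` below `19` on the open stratum; `DoorA34` stays OPEN; nothing bears on `MatrixDescartes`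
(stmt-ValiantsHypothesis-18050) or `VP ≠ VNP`.  [folklore] Leibniz expansion + the sparse Descartes rule; elementary.
-/

-- `Summit.ValiantsHypothesis.ValiantsHypothesis.…` repeats a component by the D-0017 layout
-- (single-conjunct summit), which the `dupNamespace` linter flags; the name is mandated.
set_option linter.dupNamespace false

namespace Summit.ValiantsHypothesis.ValiantsHypothesis.Theorems.LacunarySymmetroidMatrixDescartes.Census

open Polynomial Finset
open scoped BigOperators Polynomial Matrix

/-- The cube exponent `3·d l` is a triple sum (the multiset `{l,l,l}`). [folklore] -/
theorem three_mul_mem_sumset (d : Fin 4 → ℕ) (l : Fin 4) :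
    3 * d l ∈ (Finset.univ : Finset (Sym (Fin 4) 3)).image (fun s : Sym (Fin 4) 3 => ((s : Multiset (Fin 4)).map d).sum) := by
  refine Finset.mem_image.mpr ⟨Sym.replicate 3 l, Finset.mem_univ _, ?_⟩
  simp only [Sym.coe_replicate, Multiset.map_replicate, Multiset.sum_replicate, smul_eq_mul]

/-- **Two singular letters cost two monomials.**  If `3·d i ≠ 3·d j` are each uniquely represented among the triple sums of `d` and
`det (S i) = det (S j) = 0`, the pencil determinant has at most `18` monomials (any real `3 × 3` letters). [folklore] -/
theorem card_support_le_18_of_two_singular_letters (d : Fin 4 → ℕ) (S : Fin 4 → Matrix (Fin 3) (Fin 3) ℝ) (i j : Fin 4)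
    (hij : d i ≠ d j)
    (h3i : ∀ f : Fin 3 → Fin 4, (∑ k, d (f k)) = 3 * d i → ∀ k, f k = i)
    (h3j : ∀ f : Fin 3 → Fin 4, (∑ k, d (f k)) = 3 * d j → ∀ k, f k = j)
    (hi : (S i).det = 0) (hj : (S j).det = 0) :
    (Matrix.det (∑ l, ((X : ℝ[X]) ^ d l) • (S l).map C)).support.card ≤ 18 := by
  classical
  set P := Matrix.det (∑ l, ((X : ℝ[X]) ^ d l) • (S l).map C) with hP
  set T := (Finset.univ : Finset (Sym (Fin 4) 3)).image (fun s : Sym (Fin 4) 3 => ((s : Multiset (Fin 4)).map d).sum) with hT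
  have hsub : P.support ⊆ T := StubDescartesCeiling.support_det_pencil_subset d S
  have hT20 : T.card ≤ 20 :=
    Finset.card_image_le.trans (by rw [Finset.card_univ, Sym.card_sym_eq_choose]; decide)
  have hni : 3 * d i ∉ P.support := by
    rw [mem_support_iff, hP, coeff_det_pencil_three_mul d S i h3i, hi]; exact fun h => h rfl
  have hnj : 3 * d j ∉ P.support := by
    rw [mem_support_iff, hP, coeff_det_pencil_three_mul d S j h3j, hj]; exact fun h => h rfl
  have hsub' : P.support ⊆ (T.erase (3 * d i)).erase (3 * d j) := by
    intro n hn
    refine Finset.mem_erase.mpr ⟨fun h => hnj (h ▸ hn), Finset.mem_erase.mpr ⟨fun h => hni (h ▸ hn), hsub hn⟩⟩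
  have hmi : 3 * d i ∈ T := three_mul_mem_sumset d i
  have hmj : 3 * d j ∈ T.erase (3 * d i) := Finset.mem_erase.mpr ⟨by omega, three_mul_mem_sumset d j⟩
  have hcard : ((T.erase (3 * d i)).erase (3 * d j)).card = T.card - 1 - 1 := by
    rw [Finset.card_erase_of_mem hmj, Finset.card_erase_of_mem hmi]
  have := Finset.card_le_card hsub'
  omega

/-- **Two singular letters ⇒ at most `17` distinct positive roots** (sparse Descartes: fewer than the number of monomials). [folklore] -/
theorem posRoots_le_17_of_two_singular_letters (d : Fin 4 → ℕ) (S : Fin 4 → Matrix (Fin 3) (Fin 3) ℝ) (i j : Fin 4)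
    (hij : d i ≠ d j)
    (h3i : ∀ f : Fin 3 → Fin 4, (∑ k, d (f k)) = 3 * d i → ∀ k, f k = i)
    (h3j : ∀ f : Fin 3 → Fin 4, (∑ k, d (f k)) = 3 * d j → ∀ k, f k = j)
    (hi : (S i).det = 0) (hj : (S j).det = 0) :
    ((Matrix.det (∑ l, ((X : ℝ[X]) ^ d l) • (S l).map C)).roots.toFinset.filter (fun t => 0 < t)).card ≤ 17 := by
  by_cases hP : Matrix.det (∑ l, ((X : ℝ[X]) ^ d l) • (S l).map C) = 0
  · rw [hP, Polynomial.roots_zero, Multiset.toFinset_zero, Finset.filter_empty, Finset.card_empty]; omega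
  have hlt := Literature.Computability.AlgebraicComplexity.card_roots_toFinset_filter_pos_lt_card_support hP
  have h18 := card_support_le_18_of_two_singular_letters d S i j hij h3i h3j hi hj
  omega

/-- **The NULL-NULL STRATUM has ceiling `17`.**  On a support whose two END cube exponents `3·d 0 ≠ 3·d 3` are uniquely represented
(e.g. any sorted 3-Sidon support), a `(3,4)` pencil with BOTH END letters singular has at most `17` distinct positive det-roots.  By the
tree's null-null lift, `DoorA34` asks for `≤ 16` here for chain-counts with adjugate-rank end letters; this is the trivial half. [folklore] -/
theorem posRoots_le_17_of_singular_ends (d : Fin 4 → ℕ) (S : Fin 4 → Matrix (Fin 3) (Fin 3) ℝ)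
    (h03 : d 0 ≠ d 3)
    (h30 : ∀ f : Fin 3 → Fin 4, (∑ k, d (f k)) = 3 * d 0 → ∀ k, f k = 0)
    (h33 : ∀ f : Fin 3 → Fin 4, (∑ k, d (f k)) = 3 * d 3 → ∀ k, f k = 3)
    (h0 : (S 0).det = 0) (h3 : (S 3).det = 0) :
    ((Matrix.det (∑ l, ((X : ℝ[X]) ^ d l) • (S l).map C)).roots.toFinset.filter (fun t => 0 < t)).card ≤ 17 :=
  posRoots_le_17_of_two_singular_letters d S 0 3 h03 h30 h33 h0 h3

end Summit.ValiantsHypothesis.ValiantsHypothesis.Theorems.LacunarySymmetroidMatrixDescartes.Census
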